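import Literature.Barriers.Schanuel.NesterenkoModularScopeAnalytic
import Literature.Barriers.Schanuel.NesterenkoModularScopeOperator
import Mathlib.Analysis.Calculus.SmoothSeries
import Mathlib.Analysis.Calculus.IteratedDeriv.Lemmas
import Mathlib.Analysis.Convex.Topology
import HarnessLib

/-!
# Barrier (Schanuel) `NesterenkoModularScope`: `B_T(z, P(z), Q(z), R(z)) = (12z)^T F^{(T)}(z)` (LNM 1752 Ch. 3, proof of Lemma 3.4) — proofs only

`Literature/Barriers/Schanuel/NesterenkoModularScopeDerivatives.lean` — sibling proofs file of
`NesterenkoModularScopeOperator.lean` / `NesterenkoModularScopeAnalytic.lean`. No new definitions;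
proofs only. Second step of the ANALYTIC half of LNM 1752 Ch. 3 Lemma 3.4: termwise
differentiation of the Taylor series `F(z) = ∑ bₙ zⁿ` of `F = A(z, P, Q, R)` on the unit disc and,
combined with the formal identity of `NesterenkoModularScopeOperator.lean`
(`coeff_ramanujanComposite_nesterenkoB`: the Taylor coefficients of `B_T(z, P, Q, R)` are
`12^T n(n−1)⋯(n−T+1) bₙ`), the printed identity

  "`B(z, P(z), Q(z), R(z)) = (12z)^T F^{(T)}(z)`"   (Ch. 3 §3, proof of Lemma 3.4, p. 38)

as an equality of complex numbers for every `|z| < 1` (`aeval_nesterenkoB_eq_iteratedDeriv`), under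
Ramanujan's system (2) (the named fact `ramanujan1916_system`).

* `hasDerivAt_tsum_termwise`: for `‖bₙ‖ rⁿ` summable for every `r < 1`, the series
  `∑ n(n−1)⋯(n−T+1) bₙ z^{n−T}` has derivative `∑ n(n−1)⋯(n−T) bₙ z^{n−T−1}` on `|z| < 1`
  (`hasDerivAt_tsum_of_isPreconnected` on a smaller disc with the geometric majorant);
* `iteratedDeriv_tsum_eq`: hence `F^{(T)}(z) = ∑ n(n−1)⋯(n−T+1) bₙ z^{n−T}`;
* `aeval_nesterenkoB_eq_iteratedDeriv`: the displayed identity.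

## References

* [NesterenkoPhilippon2001] LNM 1752 (2001), Ch. 3 §3 (14), (19) and the proof of Lemma 3.4
  (pp. 36–38).
-/

noncomputable section

open Complex MvPolynomial Filter Topology Finset Metric
open Literature.NumberTheory.Transcendental

namespace Literature.Barriers.Schanuel

/-! ### Termwise differentiation of `∑ bₙ zⁿ` on the unit disc -/

/-- `|n(n−1)⋯(n−T+1)| ≤ n^T` (the product vanishes for `n < T`). [folklore] -/
theorem norm_descPochhammer_prod_le (T n : ℕ) :
    ‖∏ k ∈ Finset.range T, ((n : ℂ) - k)‖ ≤ (n : ℝ) ^ T := by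
  by_cases hn : n < T
  · rw [Finset.prod_eq_zero (i := n) (Finset.mem_range.mpr hn) (by simp), norm_zero]
    positivity
  · have hn : T ≤ n := not_lt.mp hn
    rw [norm_prod]
    calc ∏ k ∈ Finset.range T, ‖((n : ℂ) - k)‖ ≤ ∏ _k ∈ Finset.range T, (n : ℝ) := by
          refine Finset.prod_le_prod (fun k _ => norm_nonneg _) fun k hk => ?_
          rw [Finset.mem_range] at hk
          have hkn : (k : ℝ) ≤ n := by exact_mod_cast (hk.le.trans hn)
          rw [show ((n : ℂ) - k) = ((n - k : ℝ) : ℂ) by push_cast; ring, Complex.norm_real,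
            Real.norm_eq_abs, abs_of_nonneg (by linarith)]
          linarith [(Nat.cast_nonneg k : (0 : ℝ) ≤ k)]
      _ = (n : ℝ) ^ T := by rw [Finset.prod_const, Finset.card_range]

/-- The derivative of one term: `d/dz [n(n−1)⋯(n−T+1) bₙ z^{n−T}] = n(n−1)⋯(n−T) bₙ z^{n−T−1}`.
[folklore] -/
theorem hasDerivAt_term (b : ℕ → ℂ) (T n : ℕ) (z : ℂ) :
    HasDerivAt (fun w => (∏ k ∈ Finset.range T, ((n : ℂ) - k)) * b n * w ^ (n - T))
      ((∏ k ∈ Finset.range (T + 1), ((n : ℂ) - k)) * b n * z ^ (n - (T + 1))) z := by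
  by_cases hn : n < T
  · have h0 : (∏ k ∈ Finset.range T, ((n : ℂ) - k)) = 0 :=
      Finset.prod_eq_zero (i := n) (Finset.mem_range.mpr hn) (by simp)
    have h1 : (∏ k ∈ Finset.range (T + 1), ((n : ℂ) - k)) = 0 :=
      Finset.prod_eq_zero (i := n) (Finset.mem_range.mpr (by omega)) (by simp)
    simp only [h0, h1, zero_mul]
    exact hasDerivAt_const z 0
  · have hn' : T ≤ n := not_lt.mp hn
    have h := (hasDerivAt_pow (n - T) z).const_mul ((∏ k ∈ Finset.range T, ((n : ℂ) - k)) * b n)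
    refine h.congr_deriv ?_
    rw [Finset.prod_range_succ, Nat.cast_sub hn', show n - T - 1 = n - (T + 1) by omega]
    ring

/-- **Termwise differentiation**: if `∑ ‖bₙ‖ rⁿ < ∞` for every `0 ≤ r < 1` then on `|z| < 1`
`d/dz ∑ₙ n(n−1)⋯(n−T+1) bₙ z^{n−T} = ∑ₙ n(n−1)⋯(n−T) bₙ z^{n−T−1}`. [folklore] -/
theorem hasDerivAt_tsum_termwise (b : ℕ → ℂ)
    (hb : ∀ r : ℝ, 0 ≤ r → r < 1 → Summable fun n => ‖b n‖ * r ^ n) (T : ℕ) {z : ℂ}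
    (hz : ‖z‖ < 1) :
    HasDerivAt (fun w => ∑' n : ℕ, (∏ k ∈ Finset.range T, ((n : ℂ) - k)) * b n * w ^ (n - T))
      (∑' n : ℕ, (∏ k ∈ Finset.range (T + 1), ((n : ℂ) - k)) * b n * z ^ (n - (T + 1))) z := by
  -- two radii `‖z‖ < ρ < ρ' < 1`
  set ρ : ℝ := (‖z‖ + 1) / 2 with hρ
  set ρ' : ℝ := (ρ + 1) / 2 with hρ'
  have hz0 : 0 ≤ ‖z‖ := norm_nonneg z
  have hρ0 : 0 < ρ := by rw [hρ]; linarith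
  have hρ1 : ρ < 1 := by rw [hρ]; linarith
  have hρρ' : ρ < ρ' := by rw [hρ']; linarith
  have hρ'1 : ρ' < 1 := by rw [hρ']; linarith
  have hρ'0 : 0 < ρ' := hρ0.trans hρρ'
  have hzρ : ‖z‖ < ρ := by rw [hρ]; linarith
  clear_value ρ ρ'
  -- the bound `‖bₙ‖ ρ'ⁿ ≤ S`
  have hS := hb ρ' hρ'0.le hρ'1
  set S : ℝ := ∑' n, ‖b n‖ * ρ' ^ n with hSdef
  have hbn : ∀ n, ‖b n‖ ≤ S / ρ' ^ n := by
    intro n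
    rw [le_div_iff₀ (pow_pos hρ'0 n)]
    exact hS.le_tsum n fun m _ => by positivity
  -- the majorant `u n = S ρ^{-(T+1)} n^{T+1} (ρ/ρ')ⁿ`
  have hq : ‖(ρ / ρ' : ℝ)‖ < 1 := by
    rw [Real.norm_eq_abs, abs_of_nonneg (by positivity), div_lt_one hρ'0]; exact hρρ'
  have hu : Summable fun n : ℕ => S / ρ ^ (T + 1) * ((n : ℝ) ^ (T + 1) * (ρ / ρ') ^ n) :=
    (summable_pow_mul_geometric_of_norm_lt_one (T + 1) hq).mul_left _
  refine hasDerivAt_tsum_of_isPreconnected hu isOpen_ball (convex_ball (0 : ℂ) ρ).isPreconnected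
    (fun n y _ => hasDerivAt_term b T n y) ?_ (mem_ball_self hρ0) ?_ (by simpa using hzρ)
  · -- `‖n(n−1)⋯(n−T) bₙ y^{n−T−1}‖ ≤ u n` on `‖y‖ < ρ`
    intro n y hy
    rw [mem_ball_zero_iff] at hy
    rw [norm_mul, norm_mul, norm_pow]
    have h1 := norm_descPochhammer_prod_le (T + 1) n
    have h2 := hbn n
    have h3 : ‖y‖ ^ (n - (T + 1)) ≤ ρ ^ (n - (T + 1)) :=
      pow_le_pow_left₀ (norm_nonneg y) hy.le _
    have h4 : ρ ^ (n - (T + 1)) ≤ ρ ^ n / ρ ^ (T + 1) := by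
      rw [le_div_iff₀ (pow_pos hρ0 _), ← pow_add]
      exact pow_le_pow_of_le_one hρ0.le hρ1.le (by omega)
    have hS0 : 0 ≤ S := tsum_nonneg fun n => by positivity
    calc ‖∏ k ∈ Finset.range (T + 1), ((n : ℂ) - k)‖ * ‖b n‖ * ‖y‖ ^ (n - (T + 1))
        ≤ (n : ℝ) ^ (T + 1) * (S / ρ' ^ n) * (ρ ^ n / ρ ^ (T + 1)) := by
          refine mul_le_mul (mul_le_mul h1 h2 (norm_nonneg _) (by positivity)) (h3.trans h4)
            (by positivity) (by positivity)
      _ = S / ρ ^ (T + 1) * ((n : ℝ) ^ (T + 1) * (ρ / ρ') ^ n) := by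
          rw [div_pow]
          field_simp
  · -- convergence at the centre `0`
    refine summable_of_ne_finset_zero (s := Finset.range (T + 1)) fun n hn => ?_
    rw [Finset.mem_range, not_lt] at hn
    have : n - T ≠ 0 := by omega
    simp [zero_pow this]

/-- **`F^{(T)}(z) = ∑ₙ n(n−1)⋯(n−T+1) bₙ z^{n−T}`** for `F(z) = ∑ bₙ zⁿ` on `|z| < 1`
(`∑ ‖bₙ‖ rⁿ < ∞` for all `r < 1`). [folklore] -/
theorem iteratedDeriv_tsum_eq (b : ℕ → ℂ)
    (hb : ∀ r : ℝ, 0 ≤ r → r < 1 → Summable fun n => ‖b n‖ * r ^ n) :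
    ∀ (T : ℕ) {z : ℂ}, ‖z‖ < 1 →
      iteratedDeriv T (fun w => ∑' n : ℕ, b n * w ^ n) z =
        ∑' n : ℕ, (∏ k ∈ Finset.range T, ((n : ℂ) - k)) * b n * z ^ (n - T)
  | 0, z, _ => by simp
  | T + 1, z, hz => by
    rw [iteratedDeriv_succ]
    have hball : ball (0 : ℂ) 1 ∈ 𝓝 z := isOpen_ball.mem_nhds (by simpa using hz)
    have hev : iteratedDeriv T (fun w => ∑' n : ℕ, b n * w ^ n) =ᶠ[𝓝 z]
        fun w => ∑' n : ℕ, (∏ k ∈ Finset.range T, ((n : ℂ) - k)) * b n * w ^ (n - T) :=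
      Filter.eventuallyEq_of_mem hball fun w hw =>
        iteratedDeriv_tsum_eq b hb T (by simpa using hw)
    rw [hev.deriv_eq]
    exact (hasDerivAt_tsum_termwise b hb T hz).deriv

/-! ### The identity `B_T(z, P(z), Q(z), R(z)) = (12z)^T F^{(T)}(z)` -/

/-- **LNM 1752 Ch. 3, proof of Lemma 3.4: `B(z, P(z), Q(z), R(z)) = (12z)^T F^{(T)}(z)`** for
`F(z) = A(z, P(z), Q(z), R(z))`, `B = B_T = (12z)^T (z⁻¹D)^T A`, at every `|z| < 1` (PROVED, under
Ramanujan's system (2)). [cite: NesterenkoPhilippon2001, Ch. 3 §3 proof of Lemma 3.4 ((14), (19), p. 38)] -/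
theorem aeval_nesterenkoB_eq_iteratedDeriv (hsys : ramanujan1916_system)
    (A : MvPolynomial (Fin 4) ℤ) (T : ℕ) {z : ℂ} (hz : ‖z‖ < 1) :
    (MvPolynomial.aeval (ramanujanPoint z) (nesterenkoB A T) : ℂ) =
      (12 * z) ^ T * iteratedDeriv T (fun w => (MvPolynomial.aeval (ramanujanPoint w) A : ℂ)) z := by
  set b : ℕ → ℂ := fun n => ((PowerSeries.coeff n (ramanujanComposite A) : ℤ) : ℂ) with hbdef
  -- `∑ ‖bₙ‖ rⁿ < ∞` for `r < 1`
  have hb : ∀ r : ℝ, 0 ≤ r → r < 1 → Summable fun n => ‖b n‖ * r ^ n := by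
    intro r hr0 hr1
    have h := (hasSum_ramanujanComposite_int A (z := (r : ℂ)) (by
      rwa [Complex.norm_real, Real.norm_eq_abs, abs_of_nonneg hr0])).1
    refine h.congr fun n => ?_
    rw [norm_mul, norm_pow, Complex.norm_real, Real.norm_eq_abs, abs_of_nonneg hr0]
  -- `F = ∑ bₙ wⁿ` near `z`
  have hball : ball (0 : ℂ) 1 ∈ 𝓝 z := isOpen_ball.mem_nhds (by simpa using hz)
  have hF : (fun w => (MvPolynomial.aeval (ramanujanPoint w) A : ℂ)) =ᶠ[𝓝 z]
      fun w => ∑' n : ℕ, b n * w ^ n :=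
    Filter.eventuallyEq_of_mem hball fun w hw =>
      ((hasSum_ramanujanComposite_int A (z := w) (by simpa using hw)).2.tsum_eq).symm
  rw [hF.iteratedDeriv_eq, iteratedDeriv_tsum_eq b hb T hz, ← tsum_mul_left,
    ← (hasSum_ramanujanComposite_int (nesterenkoB A T) hz).2.tsum_eq]
  refine tsum_congr fun n => ?_
  rw [coeff_ramanujanComposite_nesterenkoB hsys]
  by_cases hn : n < T
  · have h0 : (∏ k ∈ Finset.range T, ((n : ℂ) - k)) = 0 :=
      Finset.prod_eq_zero (i := n) (Finset.mem_range.mpr hn) (by simp)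
    have h0' : (∏ k ∈ Finset.range T, ((n : ℤ) - k)) = 0 :=
      Finset.prod_eq_zero (i := n) (Finset.mem_range.mpr hn) (by simp)
    simp [h0, h0']
  · have hn : T ≤ n := not_lt.mp hn
    have hzpow : (12 * z) ^ T * z ^ (n - T) = 12 ^ T * z ^ n := by
      rw [mul_pow, mul_assoc, ← pow_add, Nat.add_sub_cancel' hn]
    push_cast
    rw [hbdef]
    linear_combination ((∏ k ∈ Finset.range T, ((n : ℂ) - k)) *
      (((PowerSeries.coeff n (ramanujanComposite A) : ℤ) : ℂ))) * hzpow.symm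

end Literature.Barriers.Schanuel

end
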